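import Mathlib.Analysis.InnerProductSpace.Basic
import Mathlib.Analysis.Complex.Basic
import Mathlib.MeasureTheory.Integral.Bochner.Basic
import Mathlib.Topology.Algebra.InfiniteSum.Real
import HarnessLib

/-!
# ENGINE-KL layer (K4e, lemmas) for `SqueezedSkewness.TorusKL` (stmt-QuantumFields-23204, stub `stub_torusMixtureData`):
# bookkeeping of bilinear integrals, Gram sums and weighted series

Generic Mathlib-only lemmas used by the Källén–Lehmann assembly `…TorusKLTorusMixture`:
* §1 `integral_bilinear_sum` ∕ `integral_linear_sum` — pulling finite (bi)linear combinations out of an integral against a weight;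
* §2 `norm_sq_sum_smul_eq` — `‖Σᵢ aᵢ • vᵢ‖² = Σᵢ Σⱼ aᵢ aⱼ ⟪vᵢ, vⱼ⟫` for real coefficients in a complex inner-product space;
* §3 regrouping over a sigma type with finite fibres: `hasSum_sigma_of_fintype_fibres` (absolutely summable, complex) and
  `hasSum_sigma_of_nonneg_fibres` (non-negative, real);
* §4 `sq_le_mul_of_weighted_series` — the weighted Cauchy–Schwarz inequality `(Σ w s Re a)² ≤ (Σ w ‖a‖²)(Σ w s²)` behind the
  non-negativity of the variance atom `W₀` (expand `Σ w ‖a − λ s‖² ≥ 0`).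
Seat `ym-line-fcl-p3` g16; theorems only; nothing about a summit, NT or the mass gap.  [folklore]
-/

set_option autoImplicit false

noncomputable section

open MeasureTheory Filter
open scoped InnerProductSpace ComplexConjugate BigOperators

namespace Summit.QuantumFields.YangMills.Theorems.TorusKL.MixtureLemmas

/-! ## §1 Finite (bi)linear combinations under the integral -/

/-- `∫ (Σᵢ aᵢ fᵢ) (Σⱼ bⱼ gⱼ) w = Σᵢ Σⱼ aᵢ bⱼ ∫ gⱼ fᵢ w` for integrable `gⱼ fᵢ w`. [folklore] -/
theorem integral_bilinear_sum {Ω : Type*} [MeasurableSpace Ω] (μ : Measure Ω) {ι ι' : Type*} [Fintype ι] [Fintype ι']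
    (a : ι → ℝ) (b : ι' → ℝ) (f : ι → Ω → ℝ) (g : ι' → Ω → ℝ) (w : Ω → ℝ)
    (hint : ∀ i j, Integrable (fun U => g j U * f i U * w U) μ) :
    ∫ U, (∑ i, a i * f i U) * (∑ j, b j * g j U) * w U ∂μ = ∑ i, ∑ j, a i * b j * ∫ U, g j U * f i U * w U ∂μ := by
  have h1 : ∀ U, (∑ i, a i * f i U) * (∑ j, b j * g j U) * w U = ∑ i, ∑ j, a i * b j * (g j U * f i U * w U) := by
    intro U
    rw [Finset.sum_mul_sum, Finset.sum_mul]
    refine Finset.sum_congr rfl fun i _ => ?_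
    rw [Finset.sum_mul]
    refine Finset.sum_congr rfl fun j _ => ?_
    ring
  simp_rw [h1]
  rw [integral_finsetSum _ fun i _ => integrable_finsetSum _ fun j _ => (hint i j).const_mul _]
  refine Finset.sum_congr rfl fun i _ => ?_
  rw [integral_finsetSum _ fun j _ => (hint i j).const_mul _]
  refine Finset.sum_congr rfl fun j _ => ?_
  exact integral_const_mul _ _

/-- `∫ (Σᵢ aᵢ fᵢ) w = Σᵢ aᵢ ∫ fᵢ w` for integrable `fᵢ w`. [folklore] -/
theorem integral_linear_sum {Ω : Type*} [MeasurableSpace Ω] (μ : Measure Ω) {ι : Type*} [Fintype ι]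
    (a : ι → ℝ) (f : ι → Ω → ℝ) (w : Ω → ℝ) (hint : ∀ i, Integrable (fun U => f i U * w U) μ) :
    ∫ U, (∑ i, a i * f i U) * w U ∂μ = ∑ i, a i * ∫ U, f i U * w U ∂μ := by
  have h1 : ∀ U, (∑ i, a i * f i U) * w U = ∑ i, a i * (f i U * w U) := by
    intro U; rw [Finset.sum_mul]; refine Finset.sum_congr rfl fun i _ => ?_; ring
  simp_rw [h1]
  rw [integral_finsetSum _ fun i _ => (hint i).const_mul _]
  exact Finset.sum_congr rfl fun i _ => integral_const_mul _ _

/-! ## §2 Gram sums -/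

/-- `‖Σᵢ aᵢ • vᵢ‖² = Σᵢ Σⱼ aᵢ aⱼ ⟪vᵢ, vⱼ⟫` (as a complex number) for REAL coefficients `aᵢ`. [folklore] -/
theorem norm_sq_sum_smul_eq {H : Type*} [NormedAddCommGroup H] [InnerProductSpace ℂ H] {ι : Type*} [Fintype ι] (a : ι → ℝ)
    (v : ι → H) :
    (((‖∑ i, (a i : ℂ) • v i‖ ^ 2 : ℝ)) : ℂ) = ∑ i, ∑ j, ((a i * a j : ℝ) : ℂ) * ⟪v i, v j⟫_ℂ := by
  rw [show (((‖∑ i, (a i : ℂ) • v i‖ ^ 2 : ℝ)) : ℂ) = ⟪∑ i, (a i : ℂ) • v i, ∑ i, (a i : ℂ) • v i⟫_ℂ from by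
    rw [inner_self_eq_norm_sq_to_K]; norm_cast, sum_inner]
  refine Finset.sum_congr rfl fun i _ => ?_
  rw [inner_sum]
  refine Finset.sum_congr rfl fun j _ => ?_
  rw [inner_smul_left, inner_smul_right, Complex.conj_ofReal]
  push_cast; ring

/-! ## §3 Sigma types with finite fibres -/

/-- From a `HasSum` of the fibre sums to a `HasSum` on the sigma type, for an absolutely summable complex family with finite fibres.
[folklore] -/
theorem hasSum_sigma_of_fintype_fibres {C : Type*} {β : C → Type*} [∀ c, Fintype (β c)] {f : (Σ c, β c) → ℂ} {a : ℂ}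
    (hf : HasSum (fun c => ∑ j, f ⟨c, j⟩) a) (hsum : Summable fun k => ‖f k‖) : HasSum f a :=
  HasSum.sigma_of_hasSum hf (fun _ => hasSum_fintype _) hsum.of_norm

/-- From a `HasSum` of the fibre sums to a `HasSum` on the sigma type, for a NON-NEGATIVE real family with finite fibres. [folklore] -/
theorem hasSum_sigma_of_nonneg_fibres {C : Type*} {β : C → Type*} [∀ c, Fintype (β c)] {f : (Σ c, β c) → ℝ} {a : ℝ}
    (hf : HasSum (fun c => ∑ j, f ⟨c, j⟩) a) (h0 : ∀ k, 0 ≤ f k) : HasSum f a := by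
  have hs : Summable f := by
    refine (summable_sigma_of_nonneg h0).2 ⟨fun c => (hasSum_fintype _).summable, ?_⟩
    have h : (fun c => ∑' j, f ⟨c, j⟩) = fun c => ∑ j, f ⟨c, j⟩ := funext fun c => tsum_fintype _
    rw [h]; exact hf.summable
  exact HasSum.sigma_of_hasSum hf (fun _ => hasSum_fintype _) hs

/-! ## §4 The weighted Cauchy–Schwarz inequality behind `W₀ ≥ 0` -/

/-- **Weighted Cauchy–Schwarz**: if `Σ w ‖a‖² = G`, `Σ w s a = m` with `m` real, `Σ w s² = Z > 0` and `w ≥ 0`, then `m² ≤ G Z`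
(expand `0 ≤ Σ w ‖a − (m/Z) s‖²`). [folklore] -/
theorem sq_le_mul_of_weighted_series {α : Type*} {w s : α → ℝ} {a : α → ℂ} {G Z m : ℝ} (hw : ∀ k, 0 ≤ w k)
    (hG : HasSum (fun k => w k * ‖a k‖ ^ 2) G) (hm : HasSum (fun k => ((w k * s k : ℝ) : ℂ) * a k) (m : ℂ))
    (hZ : HasSum (fun k => w k * s k ^ 2) Z) (hZpos : 0 < Z) : m ^ 2 ≤ G * Z := by
  set l : ℝ := m / Z with hl
  -- the real parts of the middle series
  have hre : HasSum (fun k => w k * s k * (a k).re) m := by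
    have h := Complex.hasSum_re (L := SummationFilter.unconditional _) hm
    simp only [Complex.mul_re, Complex.ofReal_re, Complex.ofReal_im, zero_mul, sub_zero] at h
    exact h
  -- the expanded non-negative series
  have hexp : ∀ k, w k * ‖a k - ((l * s k : ℝ) : ℂ)‖ ^ 2 = w k * ‖a k‖ ^ 2 - 2 * l * (w k * s k * (a k).re) + l ^ 2 * (w k * s k ^ 2) := by
    intro k
    have h1 : ‖a k - ((l * s k : ℝ) : ℂ)‖ ^ 2 = ‖a k‖ ^ 2 - 2 * (l * s k) * (a k).re + (l * s k) ^ 2 := by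
      rw [Complex.sq_norm, Complex.sq_norm, Complex.normSq_apply, Complex.normSq_apply]
      simp only [Complex.sub_re, Complex.sub_im, Complex.ofReal_re, Complex.ofReal_im, sub_zero]
      ring
    rw [h1]; ring
  have hsum : HasSum (fun k => w k * ‖a k - ((l * s k : ℝ) : ℂ)‖ ^ 2) (G - 2 * l * m + l ^ 2 * Z) := by
    simp_rw [hexp]
    exact (hG.sub (hre.mul_left (2 * l))).add (hZ.mul_left (l ^ 2))
  have hnn : 0 ≤ G - 2 * l * m + l ^ 2 * Z := hsum.nonneg fun k => mul_nonneg (hw k) (sq_nonneg _)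
  -- with `l = m / Z`: `G − m²/Z ≥ 0`
  have hZne : Z ≠ 0 := hZpos.ne'
  have hval : G - 2 * l * m + l ^ 2 * Z = G - m ^ 2 / Z := by
    rw [hl]; field_simp; ring
  rw [hval] at hnn
  have h2 : m ^ 2 / Z ≤ G := by linarith
  rwa [div_le_iff₀ hZpos] at h2

end Summit.QuantumFields.YangMills.Theorems.TorusKL.MixtureLemmas

end
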